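import Literature.NumberTheory.LFunctions.SawtoothPartialSums
import Literature.NumberTheory.LFunctions.ExceptionalPrimesAbel
import HarnessLib

/-!
# `L(1, χ)` for an odd character modulo a prime and `B_{1,χ} ≠ 0`

Let `p` be a prime and `χ` an *odd* Dirichlet character modulo `p` (`χ(-1) = -1`), with Gauss sum
`τ(χ) = ∑_a χ(a) e^{2πia/p}`. The classical evaluation of `L(1, χ̄)`
([Lang1990, Ch. 3 §2, Theorem 2.2 and "Case 2: `χ` odd"]: `L(1, χ) = (πi S(χ)/m) B_{1,χ̄}`;
it is the case `s = 1` of the functional equation, or, as here, a direct consequence of the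
Fourier series of the sawtooth function) reads

  `τ(χ) · L(1, χ̄) = -(πi/p) · ∑_{a=1}^{p-1} χ(a) a`,

i.e. `L(1, χ̄) = (πi τ(χ̄)/p) B_{1,χ}` (use `τ(χ)τ(χ̄) = χ(-1) p = -p`) with the generalized
Bernoulli number `B_{1,χ} = ∑_{a=1}^{p-1} (a/p) χ(a)` of [Schoof2009, Proposition 7.5]. Since
`L(1, χ̄) ≠ 0` (Dirichlet) and `τ(χ) ≠ 0`, **`B_{1,χ} ≠ 0` for every odd character `χ`**
([Lang1990, Ch. 2 §1: "`χ(θ) = B_{1,χ̄} ≠ 0` for odd characters … comes from its relation with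
the `L`-series"]) — the analytic input of [Schoof2009, Theorem 9.3] (the `ℤ`-rank of the
Stickelberger ideal), where it is quoted from the class number formula
`h_p⁻ = 2p ∏_{χ odd} (-B_{1,χ}/2)` [Schoof2009, Proposition 7.5].

Proof (all in this file, no named facts): `∑_a χ(a) e^{2πian/p} = χ̄(n) τ(χ)` for all `n`
(`gaussSum_mulShift`), and for odd `χ` this sum is `i ∑_a χ(a) sin(2πan/p)`; summing against
`1/n` for `n ≤ M` gives `τ(χ) ∑_{n≤M} χ̄(n)/n = -πi ∑_a χ(a) ψ_M(a/p)` with `ψ_M` the `M`-th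
partial sum of the sawtooth series (`Literature.NumberTheory.LFunctions.AFE.sawPartial`); letting
`M → ∞` with the tree's `SiegelZero.tendsto_sum_Icc_mul_cpow` (`∑_{n≤M} χ̄(n)/n → L(1, χ̄)`) and
`AFE.abs_saw_sub_sawPartial_le` (`ψ_M(a/p) → a/p - 1/2`) and using `∑_a χ(a) = 0` yields the
formula (`gaussSum_mul_LFunction_inv_one`), whence `sum_mul_val_ne_zero`.

## References

* S. Lang, *Cyclotomic Fields I and II*, GTM 121, Springer 1990 [Lang1990], Ch. 3 §2
  (Primitive `L`-series), Theorem 2.2 and the odd case; Ch. 2 §1 — held,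
  `lit read book:lang1990-cyclotomic-fields-i-ii` (chunks 62–64, 36).
* R. Schoof, *Catalan's Conjecture*, Universitext, Springer 2009, Proposition 7.5 and the proof of
  Theorem 9.3 (book p. 60) [Schoof2009] — held, `lit read book:schoof2009-catalan-s-conjecture`
  (PDF pp. 123, 140).
-/

noncomputable section

open Complex Filter Topology Finset

namespace Literature.NumberTheory.LFunctions.BernoulliOneOdd

variable {p : ℕ} [hp : Fact p.Prime]

omit hp in
/-- An odd character is non-trivial. [folklore] -/
theorem ne_one_of_odd {χ : DirichletCharacter ℂ p} (hχ : χ.Odd) : χ ≠ 1 := by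
  rintro rfl
  rw [DirichletCharacter.Odd, MulChar.one_apply isUnit_one.neg] at hχ
  norm_num at hχ

omit hp in
/-- The inverse of an odd character is odd. [folklore] -/
theorem odd_inv {χ : DirichletCharacter ℂ p} (hχ : χ.Odd) : χ⁻¹.Odd := by
  have h := hχ
  rw [DirichletCharacter.Odd] at h ⊢
  rw [MulChar.inv_apply_eq_inv', h, inv_neg_one]

omit hp in
/-- There are no odd characters modulo `2`: an odd character forces `p ≠ 2`. [folklore] -/
theorem ne_two_of_odd {χ : DirichletCharacter ℂ p} (hχ : χ.Odd) : p ≠ 2 := by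
  rintro rfl
  rw [DirichletCharacter.Odd, show (-1 : ZMod 2) = 1 from rfl, map_one] at hχ
  norm_num at hχ

/-- **`∑_a χ(a) ψ(na) = χ̄(n) τ(χ, ψ)`** for every `n` (for a unit `n` this is
`gaussSum_mulShift`; for `n = 0` both sides vanish as `χ ≠ 1`). [folklore] -/
theorem gaussSum_mulShift_eq_inv_mul {χ : DirichletCharacter ℂ p} (hχ : χ ≠ 1) (n : ZMod p) :
    gaussSum χ (ZMod.stdAddChar.mulShift n) = χ⁻¹ n * gaussSum χ ZMod.stdAddChar := by
  by_cases hn : IsUnit n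
  · exact gaussSum_mulShift_eq χ _ hn.unit
  · have hn0 : n = 0 := by
      contrapose! hn
      exact isUnit_iff_ne_zero.mpr hn
    rw [MulChar.map_nonunit _ hn, zero_mul, hn0, AddChar.mulShift_zero, gaussSum_one_right hχ]

/-- The twisted Gauss sum as an exponential sum: `∑_a χ(a) e^{2πi a n/p}`. [folklore] -/
theorem gaussSum_mulShift_eq_sum_exp (χ : DirichletCharacter ℂ p) (n : ℕ) :
    gaussSum χ (ZMod.stdAddChar.mulShift (n : ZMod p)) =
      ∑ a : ZMod p, χ a * exp (2 * Real.pi * I * ((a.val * n : ℕ) : ℂ) / p) := by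
  rw [gaussSum]
  refine sum_congr rfl fun a _ => ?_
  rw [AddChar.mulShift_apply, ZMod.stdAddChar_apply]
  congr 1
  conv_lhs => rw [← ZMod.natCast_zmod_val a, ← Nat.cast_mul, mul_comm]
  rw [ZMod.toCircle_natCast]

/-- For an odd character the exponential sum is a sine sum:
`∑_a χ(a) e^{2πian/p} = i ∑_a χ(a) sin(2πan/p)` (pair `a` with `-a`). [folklore] -/
theorem sum_mul_exp_eq_I_mul_sum_sin {χ : DirichletCharacter ℂ p} (hχ : χ.Odd) (n : ℕ) :
    ∑ a : ZMod p, χ a * exp (2 * Real.pi * I * ((a.val * n : ℕ) : ℂ) / p) =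
      I * ∑ a : ZMod p, χ a * ((Real.sin (2 * Real.pi * n * a.val / p) : ℝ) : ℂ) := by
  set S := ∑ a : ZMod p, χ a * exp (2 * Real.pi * I * ((a.val * n : ℕ) : ℂ) / p) with hS
  have hp0 : (p : ℂ) ≠ 0 := Nat.cast_ne_zero.mpr hp.out.ne_zero
  -- `S = -∑_a χ(a) e^{-2πian/p}` by `a ↦ -a`
  have hneg : S = -∑ a : ZMod p, χ a * exp (-(2 * Real.pi * I * ((a.val * n : ℕ) : ℂ) / p)) := by
    rw [hS, ← Equiv.sum_comp (Equiv.neg (ZMod p)), ← sum_neg_distrib]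
    refine sum_congr rfl fun a _ => ?_
    simp only [Equiv.neg_apply]
    rcases eq_or_ne a 0 with rfl | ha
    · simp [MulChar.map_zero]
    · rw [ZMod.neg_val, if_neg ha, ← neg_one_mul a, map_mul, hχ]
      have hle : a.val ≤ p := (ZMod.val_lt a).le
      push_cast [Nat.cast_sub hle]
      have : 2 * Real.pi * I * (((p : ℂ) - a.val) * n) / p
          = (n : ℂ) * (2 * Real.pi * I) + -(2 * Real.pi * I * ((a.val : ℂ) * n) / p) := by
        field_simp
        ring
      rw [this, exp_add, exp_nat_mul_two_pi_mul_I, one_mul]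
      ring
  -- the difference of the two expressions
  have h2 : 2 * S = ∑ a : ZMod p, χ a * (exp (2 * Real.pi * I * ((a.val * n : ℕ) : ℂ) / p)
      - exp (-(2 * Real.pi * I * ((a.val * n : ℕ) : ℂ) / p))) := by
    have : 2 * S = S - -S := by ring
    rw [this]
    nth_rewrite 2 [hneg]
    rw [neg_neg, hS, ← sum_sub_distrib]
    exact sum_congr rfl fun a _ => by ring
  have h3 : ∀ a : ZMod p, exp (2 * Real.pi * I * ((a.val * n : ℕ) : ℂ) / p)
      - exp (-(2 * Real.pi * I * ((a.val * n : ℕ) : ℂ) / p))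
      = 2 * I * ((Real.sin (2 * Real.pi * n * a.val / p) : ℝ) : ℂ) := by
    intro a
    rw [Complex.ofReal_sin, Complex.sin]
    push_cast
    have e1 : -(2 * (Real.pi : ℂ) * n * a.val / p) * I = -(2 * Real.pi * I * (a.val * n) / p) := by ring
    have e2 : 2 * (Real.pi : ℂ) * n * a.val / p * I = 2 * Real.pi * I * (a.val * n) / p := by ring
    rw [e1, e2]
    ring_nf
    rw [I_sq]
    ring
  simp_rw [h3] at h2
  have h4 : 2 * S = 2 * (I * ∑ a : ZMod p,
      χ a * ((Real.sin (2 * Real.pi * n * a.val / p) : ℝ) : ℂ)) := by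
    rw [h2, mul_sum, mul_sum]
    exact sum_congr rfl fun a _ => by ring
  exact mul_left_cancel₀ two_ne_zero h4

/-- `∑_{n=1}^{M} sin(2πnx)/n = -π ψ_M(x)` in terms of the sawtooth partial sum
`ψ_M = AFE.sawPartial M`. [folklore] -/
theorem sum_sin_div_eq (M : ℕ) (x : ℝ) :
    ∑ n ∈ Icc 1 M, Real.sin (2 * Real.pi * n * x) / n = -Real.pi * AFE.sawPartial M x := by
  rw [AFE.sawPartial, mul_neg, neg_mul, neg_neg, Finset.mul_sum]
  refine sum_congr rfl fun n hn => ?_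
  have hn0 : (n : ℝ) ≠ 0 := Nat.cast_ne_zero.mpr (by have := (mem_Icc.mp hn).1; omega)
  field_simp

/-- **The finite identity**: `τ(χ) ∑_{n ≤ M} χ̄(n)/n = -πi ∑_a χ(a) ψ_M(a/p)` for odd `χ`.
[cite: Lang1990, Ch. 3 §2, Theorem 2.2 (proof, odd case)] -/
theorem gaussSum_mul_sum_inv_div {χ : DirichletCharacter ℂ p} (hχ : χ.Odd) (M : ℕ) :
    gaussSum χ ZMod.stdAddChar * ∑ n ∈ Icc 1 M, χ⁻¹ (n : ZMod p) / n =
      -(Real.pi * I) * ∑ a : ZMod p, χ a * ((AFE.sawPartial M ((a.val : ℝ) / p) : ℝ) : ℂ) := by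
  have hχ1 := ne_one_of_odd hχ
  calc gaussSum χ ZMod.stdAddChar * ∑ n ∈ Icc 1 M, χ⁻¹ (n : ZMod p) / n
      = ∑ n ∈ Icc 1 M, gaussSum χ (ZMod.stdAddChar.mulShift (n : ZMod p)) / n := by
        rw [mul_sum]
        refine sum_congr rfl fun n _ => ?_
        rw [gaussSum_mulShift_eq_inv_mul hχ1]
        ring
    _ = ∑ n ∈ Icc 1 M, I * (∑ a : ZMod p,
          χ a * ((Real.sin (2 * Real.pi * n * a.val / p) : ℝ) : ℂ)) / n := by
        refine sum_congr rfl fun n _ => ?_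
        rw [gaussSum_mulShift_eq_sum_exp, sum_mul_exp_eq_I_mul_sum_sin hχ]
    _ = I * ∑ a : ZMod p, χ a *
          ((∑ n ∈ Icc 1 M, Real.sin (2 * Real.pi * n * ((a.val : ℝ) / p)) / n : ℝ) : ℂ) := by
        rw [mul_sum]
        simp_rw [Complex.ofReal_sum, mul_sum, sum_div]
        rw [sum_comm]
        refine sum_congr rfl fun a _ => sum_congr rfl fun n _ => ?_
        have : 2 * Real.pi * n * ((a.val : ℝ) / p) = 2 * Real.pi * n * a.val / p := by ring
        rw [this]
        push_cast
        ring
    _ = -(Real.pi * I) * ∑ a : ZMod p, χ a * ((AFE.sawPartial M ((a.val : ℝ) / p) : ℝ) : ℂ) := by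
        simp_rw [sum_sin_div_eq]
        rw [mul_sum, mul_sum]
        refine sum_congr rfl fun a _ => ?_
        push_cast
        ring

/-- The sawtooth partial sums converge: `ψ_M(a/p) → a/p - 1/2` for `0 < a < p`.
[cite: Titchmarsh1986, §4.7] -/
theorem tendsto_sawPartial {a : ℕ} (ha0 : 0 < a) (hap : a < p) :
    Tendsto (fun M : ℕ => AFE.sawPartial M ((a : ℝ) / p)) atTop (𝓝 ((a : ℝ) / p - 1 / 2)) := by
  set x : ℝ := (a : ℝ) / p with hx
  have hp0 : (0 : ℝ) < p := by exact_mod_cast hp.out.pos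
  have hx0 : 0 < x := div_pos (by exact_mod_cast ha0) hp0
  have hx1 : x < 1 := by rw [hx, div_lt_one hp0]; exact_mod_cast hap
  have hfract : Int.fract x = x := by
    rw [Int.fract_eq_self]; exact ⟨hx0.le, hx1⟩
  have hsaw : AFE.saw x = x - 1 / 2 := by rw [AFE.saw_def, hfract]
  set m : ℝ := min (Int.fract x) (1 - Int.fract x) with hm
  have hm0 : 0 < m := by rw [hm, hfract]; exact lt_min hx0 (by linarith)
  have hbound : ∀ M : ℕ, |AFE.sawPartial M x - (x - 1 / 2)| ≤
      1 / ((2 * M + 1) * Real.pi * m) := by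
    intro M
    rw [← hsaw, abs_sub_comm]
    exact AFE.abs_saw_sub_sawPartial_le M (by rw [hfract]; exact hx0.ne')
  have hlim : Tendsto (fun M : ℕ => ((2 * (M : ℝ) + 1) * Real.pi * m)⁻¹) atTop (𝓝 0) := by
    have h1 : Tendsto (fun M : ℕ => (2 * (M : ℝ) + 1) * Real.pi * m) atTop atTop := by
      refine Tendsto.atTop_mul_const hm0 (Tendsto.atTop_mul_const Real.pi_pos ?_)
      exact tendsto_atTop_add_const_right _ 1
        (Tendsto.const_mul_atTop two_pos tendsto_natCast_atTop_atTop)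
    exact h1.inv_tendsto_atTop
  rw [tendsto_iff_norm_sub_tendsto_zero]
  refine squeeze_zero (fun M => norm_nonneg _) (fun M => ?_) hlim
  rw [Real.norm_eq_abs, ← one_div]
  exact hbound M

/-- **`L(1, χ̄)` for odd `χ` modulo a prime `p`**:
`τ(χ) L(1, χ̄) = -(πi/p) ∑_{a=1}^{p-1} χ(a) a`, `τ(χ) = ∑_a χ(a) e^{2πia/p}` (equivalently, with
`τ(χ)τ(χ̄) = -p`: `L(1, χ̄) = (πi τ(χ̄)/p) B_{1,χ}`, Lang's `L(1,χ) = (πi S(χ)/m) B_{1,χ̄}`).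
[cite: Lang1990, Ch. 3 §2, Theorem 2.2 (Case 2, χ odd)] -/
theorem gaussSum_mul_LFunction_inv_one {χ : DirichletCharacter ℂ p} (hχ : χ.Odd) :
    gaussSum χ ZMod.stdAddChar * χ⁻¹.LFunction 1 =
      -(Real.pi * I / p) * ∑ a : ZMod p, χ a * (a.val : ℂ) := by
  have hχ1 := ne_one_of_odd hχ
  -- left-hand side: limit of the partial sums
  have hL : Tendsto (fun M : ℕ => gaussSum χ ZMod.stdAddChar *
      ∑ n ∈ Icc 1 M, χ⁻¹ (n : ZMod p) / n)
      atTop (𝓝 (gaussSum χ ZMod.stdAddChar * χ⁻¹.LFunction 1)) := by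
    refine Tendsto.const_mul _ ?_
    have h := SiegelZero.tendsto_sum_Icc_mul_cpow χ⁻¹ (inv_ne_one.mpr hχ1) (s := 1) (by simp)
    refine h.congr fun M => sum_congr rfl fun n _ => ?_
    rw [cpow_neg_one, div_eq_mul_inv]
  -- right-hand side: termwise limits of the sawtooth partial sums
  have hR : Tendsto (fun M : ℕ => -(Real.pi * I) * ∑ a : ZMod p,
      χ a * ((AFE.sawPartial M ((a.val : ℝ) / p) : ℝ) : ℂ)) atTop
      (𝓝 (-(Real.pi * I) * ∑ a : ZMod p, χ a * ((((a.val : ℝ) / p - 1 / 2 : ℝ)) : ℂ))) := by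
    refine Tendsto.const_mul _ (tendsto_finsetSum _ fun a _ => ?_)
    rcases eq_or_ne a 0 with rfl | ha
    · simp only [MulChar.map_zero, zero_mul]
      exact tendsto_const_nhds
    · refine Tendsto.const_mul _ ?_
      exact (continuous_ofReal.tendsto _).comp
        (tendsto_sawPartial (Nat.pos_of_ne_zero ((ZMod.val_ne_zero a).mpr ha)) (ZMod.val_lt a))
  have hEq : (fun M : ℕ => gaussSum χ ZMod.stdAddChar * ∑ n ∈ Icc 1 M, χ⁻¹ (n : ZMod p) / n)
      = fun M : ℕ => -(Real.pi * I) * ∑ a : ZMod p,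
          χ a * ((AFE.sawPartial M ((a.val : ℝ) / p) : ℝ) : ℂ) :=
    funext fun M => gaussSum_mul_sum_inv_div hχ M
  rw [hEq] at hL
  rw [tendsto_nhds_unique hL hR]
  -- simplify `∑_a χ(a) (a/p - 1/2) = (1/p) ∑_a χ(a) a` using `∑_a χ(a) = 0`
  have hsum0 : ∑ a : ZMod p, χ a = 0 := MulChar.sum_eq_zero_of_ne_one hχ1
  have hp0 : (p : ℂ) ≠ 0 := Nat.cast_ne_zero.mpr hp.out.ne_zero
  have : ∑ a : ZMod p, χ a * ((((a.val : ℝ) / p - 1 / 2 : ℝ)) : ℂ)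
      = (1 / p) * ∑ a : ZMod p, χ a * (a.val : ℂ) - (1 / 2) * ∑ a : ZMod p, χ a := by
    rw [mul_sum, mul_sum, ← sum_sub_distrib]
    refine sum_congr rfl fun a _ => ?_
    push_cast
    ring
  rw [this, hsum0, mul_zero, sub_zero]
  field_simp

/-- **`B_{1,χ} ≠ 0` for odd `χ`**: for an odd Dirichlet character `χ` modulo a prime `p`,
`∑_{a=1}^{p-1} χ(a) a ≠ 0` (`= p B_{1,χ}`), since `τ(χ) ≠ 0` and `L(1, χ̄) ≠ 0`.
[cite: Schoof2009, Proposition 7.5 and proof of Theorem 9.3 (p. 60)] -/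
theorem sum_mul_val_ne_zero {χ : DirichletCharacter ℂ p} (hχ : χ.Odd) :
    ∑ a : ZMod p, χ a * (a.val : ℂ) ≠ 0 := by
  have hχ1 := ne_one_of_odd hχ
  intro h0
  have h := gaussSum_mul_LFunction_inv_one hχ
  rw [h0, mul_zero] at h
  rcases mul_eq_zero.mp h with hτ | hL
  · refine gaussSum_ne_zero_of_nontrivial ?_ hχ1 (ZMod.isPrimitive_stdAddChar p) hτ
    rw [ZMod.card]
    exact Nat.cast_ne_zero.mpr hp.out.ne_zero
  · exact DirichletCharacter.LFunction_apply_one_ne_zero (inv_ne_one.mpr hχ1) hL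

/-- The same with `χ(a)⁻¹`: `∑_a χ̄(a) a ≠ 0` for odd `χ` (apply the previous result to `χ̄`).
[cite: Schoof2009, proof of Theorem 9.3 (p. 60)] -/
theorem sum_inv_mul_val_ne_zero {χ : DirichletCharacter ℂ p} (hχ : χ.Odd) :
    ∑ a : ZMod p, χ⁻¹ a * (a.val : ℂ) ≠ 0 :=
  sum_mul_val_ne_zero (odd_inv hχ)

end Literature.NumberTheory.LFunctions.BernoulliOneOdd
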